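import Literature.NumberTheory.EllipticCurves.IsogenyGroundFieldExtension
import Literature.NumberTheory.EllipticCurves.ShafarevichGoodReductionBadPlacesProofs
import Literature.NumberTheory.EllipticCurves.IsogenyFrobeniusTraceProofs
import Literature.NumberTheory.EllipticCurves.IsogenyQuadraticTwistProofs
import Literature.NumberTheory.EllipticCurves.Rank1Residual.GVParityTwistTransportProofs
import Summits.BirchSwinnertonDyer.Rank1Residual.Additive.GordFieldOrdinary
import Summits.BirchSwinnertonDyer.Rank1Residual.Additive.MinimalGoodReductionField
import Summits.BirchSwinnertonDyer.Rank1Residual.Additive.DictionaryUniform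
import HarnessLib

/-!
# X3♯/X4♯ (G-ord): the (G)-cell is an ISOGENY-CLASS invariant — type (G), the semistability defect,
# (G)-ordinarity and the sub-classes X3♯(G-ord), X4♯(G-ord) transfer along every `ℚ`-isogeny

HONEST FRAMING (cell `b2b-bsdres`, run/shared/lean/b2b/bsd-rank1-residual/, verbatim in every
file): the goal of the cell is to DELETE the COMBINATION-SHAPED residual classes of the
Birch–Swinnerton-Dyer formula for ALL analytic-rank `≤ 1` elliptic curves over `ℚ` — "full BSD
formula for every rank `≤ 1` curve in class `C`" assembled STRICTLY from published theorems — so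
that the rank-`≤ 1` remainder becomes exactly the CONSTRUCTION-SHAPED classes, which are TYPED
(missing-input `Prop`s), NOT attempted. This is not "finishing BSD". Sub-cell `additive-p2`
(CLASS-OWNERS row "X3/X4 additive — pot. good ordinary / X3♯(G-ord)"), generation 15: research
route; no claim beyond the stated classes; theorems only, no definition, no new named fact;
X3♯(G-ord)/X4♯(G-ord) stay CONSTRUCTION-SHAPED; nothing is booked by this file.

WHAT THIS FILE DOES. Every predicate of the sub-cell's dictionary is defined on a Weierstrass MODEL
`W/ℚ` (`TypeG`, `TypeGOrd`: good [ordinary] reduction of `W_F` above `p` for a subfield `F` of a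
`p`-th cyclotomic field; `semistabilityIndex W p = 12/gcd(12, ord_p Δ_min)`; `ClassX3Gord`,
`ClassX4Gord`), and the class theorems of gens 4–14 carry their hypotheses on ONE curve of an
isogeny class (gen 14: the strong curve `W₀`, `GordManinConstant.lean`, transporting only `BSDp`
to the other members by Cassels). Gen 14's data note recorded that the Kodaira TYPE is NOT constant
on a `ℚ`-isogeny class at a potentially good additive `p` (634 of 32 238 classes in Cremona
`N < 120 000` mix II/II*, III/III*, IV/IV*), and asserted without proof that (G)-ordinarity is.
This file PROVES it, for the whole dictionary, from the tree's isogeny theory: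

* `TypeG.of_isIsogenous`, `typeG_iff_of_isIsogenous` — **type (G) is a `ℚ`-isogeny invariant**
  (ANY prime `p`, any models): a `ℚ`-isogeny `W ∼ W'` extends to an `F`-isogeny `W_F ∼ W'_F`
  (`IsIsogenous.extendScalars`, Silverman *AEC* III.§4), and `F`-isogenous curves have the same
  places of good reduction (*AEC* Cor. VII.7.2, the tree's theorem
  `IsIsogenous.hasGoodReductionAt_iff_of_isIsogenous`).
* `Addv.of_isIsogenous_of_typeG`, `padicValRat_j_nonneg_of_isIsogenous_of_typeG` — on the
  (G)-cell, "additive with `ord_p j ≥ 0`" transfers (`p ∤`-free: bad at `p` by VII.7.2 over `ℚ`,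
  not multiplicative because `ord_p j(W') ≥ 0`, *AEC* VII.5.5 = `padicValRat_j_nonneg_of_typeG`).
* `semistabilityIndex_eq_of_isIsogenous_of_typeG` — **the semistability defect `e_E(p) ∈ {2,3,4,6}`
  is constant on the `ℚ`-isogeny class of a (G)-pair** (`p ≥ 5`, globally minimal models): over
  the minimal (G)-field `F₀ ⊆ ℚ(ζ_p)` of `W` (degree `e_W(p)`, gen 5
  `typeG_iff_exists_intermediateField_finrank_eq_semistabilityIndex`) the isogenous `W'` is good
  too, so `e_{W'}(p) ∣ [F₀ : ℚ] = e_W(p)` (gen 5 `TypeG.forall_hasGoodReductionAt_iff_dvd_finrank`),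
  and symmetrically. Equivalently `gcd(12, ord_p Δ_min)` is a class invariant
  (`gcd_padicValInt_minimalDiscriminantInt_eq_of_isIsogenous_of_typeG`): inside a class the
  Kodaira type at `p` moves at most between II and II* (`e = 6`), III and III* (`e = 4`), IV and IV*
  (`e = 3`), and stays I₀* (`e = 2`) — EXACTLY the freedom gen 14's census observed.
* `TypeGOrd.of_isIsogenous`, `typeGOrd_iff_of_isIsogenous` — **(G)-ORDINARITY is a `ℚ`-isogeny
  invariant** (every odd `p`): for defect `≠ 2` it is type (G) (gen 5
  `typeGOrd_of_typeG_of_semistabilityIndex_ne_two`); for defect `2` it is "the twist `E^{(p*)}` is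
  good ORDINARY at `p`" (gen 4 `typeGOrd_iff_goodOrd_twist_pStar`; at `p = 3` gen 7's
  `typeGOrd_three_iff_goodOrd_twist`, Tate's algorithm), twisting commutes with isogenies (Cremona
  §3.9, the tree's `IsIsogenous.quadraticTwist`) and `ℚ`-isogenous curves have the same `a_p` at a
  good prime (Faltings' Korollar 2 (i) ⇒ (iv) / *AEC* Ex. 5.4, the tree's theorem
  `frobeniusTrace_eq_of_isIsogenous`).
* Sibling file `GordIsogenyInvarianceClasses.lean`: the census cell (G-ord) = `SubGord` and the
  sub-classes X3♯(G-ord), X4♯(G-ord) are `ℚ`-isogeny-class properties (every odd `p`).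

EFFECT (bookkeeping, no label moves): the hypotheses `ClassX4Gord W₀ p` / `¬TypeGOrd W₀ p` of gen
14's strong-curve theorems (`ClassX4.bsdp_of_isIsogenous_of_strong_of_lowerHalves`,
`Addv.typeGOrd_and_le_four_of_dvd_maninConstant`) may be checked on ANY member of the class; only
the Kodaira bit `ord_p Δ_min(W₀) ≤ 4` of Edixhoven's exception must be read on the strong curve,
and it can differ from the given member's only by `v ↦ 12 − v` within the same defect. The
census of the cell (X3♯(G-ord) 334 ‖ 191, X4♯(G-ord) 946 ‖ 240 pairs, by isogeny class) is
thereby a count of CLASSES in the kernel's sense too. Located gap / labels UNCHANGED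
(HOME/b2b-bsdres-additive-p2/AUDIT-X34-GORD.md §4).

References: J. H. Silverman, *AEC* (2nd ed.) III.§4, Cor. VII.7.2, VII.5.5, Ex. 5.4;
G. Faltings, Invent. Math. 73 (1983) §5 Kor. 2; J. E. Cremona, *Algorithms for Modular Elliptic
Curves* §3.9; D. Delbourgo, Compositio Math. 113 (1998) §1.5 (hypothesis (G)).
-/

noncomputable section

open scoped Classical NumberField

open WeierstrassCurve IsDedekindDomain IsDedekindDomain.HeightOneSpectrum NumberField
  Rat.HeightOneSpectrum Literature.NumberTheory.EllipticCurves
  Literature.NumberTheory.EllipticCurves.Rank1Residual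

namespace Summit.BirchSwinnertonDyer.Rank1Residual.Additive

/-! ### Good reduction at a rational prime is a `ℚ`-isogeny invariant (Cor. VII.7.2 at `K = ℚ`) -/

/-- **`ℚ`-isogenous elliptic curves have the same primes of good reduction** — Silverman *AEC*
Cor. VII.7.2 (the tree's theorem `IsIsogenous.hasGoodReductionAt_iff_of_isIsogenous` over the
number field `ℚ`) in the `HasGoodReductionAtPrime p` vocabulary of the residual classes
(bridge `hasGoodReductionAtPrime_iff_hasGoodReductionAt_ringOfIntegers`). -/
theorem hasGoodReductionAtPrime_iff_of_isIsogenous {W W' : WeierstrassCurve ℚ} [W.IsElliptic]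
    [W'.IsElliptic] (h : IsIsogenous W W') (p : ℕ) [hp : Fact p.Prime] :
    W.HasGoodReductionAtPrime p ↔ W'.HasGoodReductionAtPrime p := by
  obtain ⟨v, rfl⟩ : ∃ v : HeightOneSpectrum (𝓞 ℚ), (primesEquiv v : ℕ) = p :=
    ⟨primesEquiv.symm ⟨p, hp.out⟩, by rw [Equiv.apply_symm_apply]⟩
  rw [hasGoodReductionAtPrime_iff_hasGoodReductionAt_ringOfIntegers v W,
    hasGoodReductionAtPrime_iff_hasGoodReductionAt_ringOfIntegers v W']
  exact h.hasGoodReductionAt_iff_of_isIsogenous v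

/-! ### Type (G) is an isogeny invariant (any `p`) -/

section TypeG

variable {W W' : WeierstrassCurve ℚ} [W.IsElliptic] [W'.IsElliptic] {p : ℕ} [hp : Fact p.Prime]

omit hp in
/-- **Delbourgo's hypothesis (G) is a `ℚ`-isogeny invariant.** If `(E, p)` is of type (G) — `E_F` is
good above `p` for some subfield `F` of a `p`-th cyclotomic field — and `E ∼ E'` over `ℚ`, then
`(E', p)` is of type (G), with the SAME field `F`: the `ℚ`-isogeny extends to an `F`-isogeny
`E_F ∼ E'_F` (`IsIsogenous.extendScalars`, Silverman *AEC* III.§4) and `F`-isogenous curves have the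
same places of good reduction (*AEC* Cor. VII.7.2, `IsIsogenous.hasGoodReductionAt_iff_of_isIsogenous`).
No hypothesis on `p` or on the models. -/
theorem TypeG.of_isIsogenous (hG : TypeG W p) (h : IsIsogenous W W') : TypeG W' p := by
  obtain ⟨L, iF, iN, iC, F, hF⟩ := hG
  refine ⟨L, iF, iN, iC, F, fun w hw ↦ ?_⟩
  haveI : NumberField F := NumberField.of_module_finite ℚ F
  haveI : (W.baseChange F).IsElliptic := by rw [baseChange]; infer_instance
  haveI : (W'.baseChange F).IsElliptic := by rw [baseChange]; infer_instance
  have hiso : IsIsogenous (W.baseChange F) (W'.baseChange F) := h.extendScalars F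
  exact (hiso.hasGoodReductionAt_iff_of_isIsogenous w).mp (hF w hw)

omit hp in
/-- **Type (G) is constant on `ℚ`-isogeny classes**: `TypeG W p ↔ TypeG W' p` for `W ∼ W'`
(the converse through the dual isogeny, `IsIsogenous.symm_of_charZero`). -/
theorem typeG_iff_of_isIsogenous (h : IsIsogenous W W') : TypeG W p ↔ TypeG W' p :=
  ⟨fun hG ↦ hG.of_isIsogenous h, fun hG ↦ hG.of_isIsogenous h.symm_of_charZero⟩

/-- **On the (G)-cell, `ord_p j ≥ 0` transfers along isogenies**: `(E, p)` of type (G) and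
`E ∼ E'` give `ord_p j(E') ≥ 0` (potential good reduction forces integral `j`, *AEC* VII.5.5,
`padicValRat_j_nonneg_of_typeG`, applied to `E'`). -/
theorem padicValRat_j_nonneg_of_isIsogenous_of_typeG (hG : TypeG W p) (h : IsIsogenous W W') :
    0 ≤ padicValRat p W'.j :=
  padicValRat_j_nonneg_of_typeG W' p (hG.of_isIsogenous h)

/-- **On the (G)-cell, additivity at `p` transfers along isogenies**: `E` additive at `p` of type (G)
and `E ∼ E'` (`W'` globally minimal) ⟹ `E'` additive at `p`. Bad at `p` because good reduction at
`p` is an isogeny invariant (`hasGoodReductionAtPrime_iff_of_isIsogenous`); not multiplicative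
because `ord_p j(E') ≥ 0` (`padicValRat_j_nonneg_of_isIsogenous_of_typeG`) while a multiplicative
prime has `ord_p j < 0` (`EisensteinPrimes.padicValRat_j_neg_of_mult`). -/
theorem Addv.of_isIsogenous_of_typeG [W'.IsGloballyMinimal] (hadd : Addv W p) (hG : TypeG W p)
    (h : IsIsogenous W W') : Addv W' p := by
  refine ⟨fun hgood ↦ hadd.1 ((hasGoodReductionAtPrime_iff_of_isIsogenous h p).mpr hgood),
    fun hmult ↦ ?_⟩
  have hj := padicValRat_j_nonneg_of_isIsogenous_of_typeG hG h
  exact absurd (EisensteinPrimes.padicValRat_j_neg_of_mult W' p hmult) (not_lt.mpr hj)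

end TypeG

/-! ### The semistability defect is constant on the isogeny class of a (G)-pair (`p ≥ 5`) -/

section Defect

variable {W W' : WeierstrassCurve ℚ} [W.IsElliptic] [W.IsGloballyMinimal] [W'.IsElliptic]
  [W'.IsGloballyMinimal] {p : ℕ} [hp : Fact p.Prime]

/-- The `p`-th cyclotomic field `CyclotomicField p ℚ` is a `p`-th cyclotomic extension of `ℚ` for
the `ℚ`-algebra structure `DivisionRing.toRatAlgebra` used by the dictionary files (the two
`ℚ`-algebra structures agree, `Subsingleton`). -/
theorem isCyclotomicExtension_cyclotomicField_rat (p : ℕ) [Fact p.Prime] :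
    IsCyclotomicExtension {p} ℚ (CyclotomicField p ℚ) := by
  have h : (CyclotomicField.algebra p ℚ : Algebra ℚ (CyclotomicField p ℚ)) =
      DivisionRing.toRatAlgebra :=
    Subsingleton.elim _ _
  exact h ▸ CyclotomicField.isCyclotomicExtension p ℚ

/-- One direction of the defect comparison: for `(E, p)` of type (G), `p ≥ 5`, and `E ∼ E'`,
**`e_{E'}(p) ∣ e_E(p)`** — `E'` (of type (G) too) is good above `p` over the minimal (G)-field of `E`,
of degree `e_E(p)` (gen 5 `typeG_iff_exists_intermediateField_finrank_eq_semistabilityIndex`), and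
the (G)-fields of `E'` are exactly the subfields of degree divisible by `e_{E'}(p)` (gen 5
`TypeG.forall_hasGoodReductionAt_iff_dvd_finrank`). -/
theorem semistabilityIndex_dvd_of_isIsogenous_of_typeG (hp5 : 5 ≤ p) (hG : TypeG W p)
    (h : IsIsogenous W W') : semistabilityIndex W' p ∣ semistabilityIndex W p := by
  haveI := isCyclotomicExtension_cyclotomicField_rat p
  have hG' : TypeG W' p := hG.of_isIsogenous h
  obtain ⟨F, hFd, hFgood⟩ :=
    (typeG_iff_exists_intermediateField_finrank_eq_semistabilityIndex W p (CyclotomicField p ℚ)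
      hp5).mp hG
  haveI : NumberField F := NumberField.of_module_finite ℚ F
  haveI : (W.baseChange F).IsElliptic := by rw [baseChange]; infer_instance
  haveI : (W'.baseChange F).IsElliptic := by rw [baseChange]; infer_instance
  have hiso : IsIsogenous (W.baseChange F) (W'.baseChange F) := h.extendScalars F
  have hF'good : ∀ w : HeightOneSpectrum (𝓞 F), (p : 𝓞 F) ∈ w.asIdeal →
      (W'.baseChange F).HasGoodReductionAt w := fun w hw ↦
    (hiso.hasGoodReductionAt_iff_of_isIsogenous w).mp (hFgood w hw)
  rw [← hFd]
  exact (TypeG.forall_hasGoodReductionAt_iff_dvd_finrank W' p (CyclotomicField p ℚ) hp5 hG' F).mp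
    hF'good

/-- **The semistability defect is a `ℚ`-isogeny invariant on the (G)-cell** (`p ≥ 5`, globally
minimal models): `E` of type (G) at `p` and `E ∼ E'` ⟹ `e_{E'}(p) = e_E(p)`
(`semistabilityIndex`, Delbourgo's `d`, the order of the inertia image; both divisibilities by
`semistabilityIndex_dvd_of_isIsogenous_of_typeG`, the second along the dual isogeny). -/
theorem semistabilityIndex_eq_of_isIsogenous_of_typeG (hp5 : 5 ≤ p) (hG : TypeG W p)
    (h : IsIsogenous W W') : semistabilityIndex W' p = semistabilityIndex W p :=
  Nat.dvd_antisymm (semistabilityIndex_dvd_of_isIsogenous_of_typeG hp5 hG h)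
    (semistabilityIndex_dvd_of_isIsogenous_of_typeG hp5 (hG.of_isIsogenous h) h.symm_of_charZero)

/-- **The semistability defect is a `ℚ`-isogeny invariant on the additive (G)-cell at every odd
prime**: `E` additive at `p` of type (G), `E ∼ E'` ⟹ `e_{E'}(p) = e_E(p)` (`p ≥ 5`:
`semistabilityIndex_eq_of_isIsogenous_of_typeG`; `p = 3`: both are `2`, gen 7's
`semistabilityIndex_eq_two_of_typeG_three`, Kodaira I₀*). -/
theorem semistabilityIndex_eq_of_isIsogenous_of_typeG_of_addv (hp2 : p ≠ 2) (hadd : Addv W p)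
    (hG : TypeG W p) (h : IsIsogenous W W') : semistabilityIndex W' p = semistabilityIndex W p := by
  rcases eq_three_or_five_le_of_prime_ne_two p hp.out hp2 with rfl | hp5
  · rw [semistabilityIndex_eq_two_of_typeG_three W hG hadd,
      semistabilityIndex_eq_two_of_typeG_three W' (hG.of_isIsogenous h)
        (Addv.of_isIsogenous_of_typeG hadd hG h)]
  · exact semistabilityIndex_eq_of_isIsogenous_of_typeG hp5 hG h

/-- **`gcd(12, ord_p Δ_min)` is a `ℚ`-isogeny invariant on the (G)-cell** (`p ≥ 5`): the form of
`semistabilityIndex_eq_of_isIsogenous_of_typeG` on the minimal discriminants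
(`e = 12 / gcd(12, ord_p Δ_min)`, `gcd(12, ·) ∣ 12`). With gen 14's dictionary
(`GordKodairaType.lean`: II ↦ 2, III ↦ 3, IV ↦ 4, I₀* ↦ 6, IV* ↦ 8, III* ↦ 9, II* ↦ 10) this says
the Kodaira type at `p` moves inside a class at most between II and II*, III and III*, IV and IV*,
and stays I₀* — Edixhoven's exception bit `ord_p Δ_min ≤ 4` is NOT a class invariant, the defect is. -/
theorem gcd_padicValInt_minimalDiscriminantInt_eq_of_isIsogenous_of_typeG (hp5 : 5 ≤ p)
    (hG : TypeG W p) (h : IsIsogenous W W') :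
    Nat.gcd 12 (padicValInt p W'.minimalDiscriminantInt) =
      Nat.gcd 12 (padicValInt p W.minimalDiscriminantInt) := by
  have he := semistabilityIndex_eq_of_isIsogenous_of_typeG hp5 hG h
  unfold semistabilityIndex at he
  set g := Nat.gcd 12 (padicValInt p W.minimalDiscriminantInt) with hg
  set g' := Nat.gcd 12 (padicValInt p W'.minimalDiscriminantInt) with hg'
  have hd : g ∣ 12 := Nat.gcd_dvd_left _ _
  have hd' : g' ∣ 12 := Nat.gcd_dvd_left _ _
  have hpos : 0 < g := Nat.gcd_pos_of_pos_left _ (by norm_num)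
  -- `12 / g' = 12 / g` with `g, g' ∣ 12` forces `g' = g`
  have hq : 0 < 12 / g := Nat.div_pos (Nat.le_of_dvd (by norm_num) hd) hpos
  have h1 : 12 / g' * g' = 12 := Nat.div_mul_cancel hd'
  have h2 : 12 / g * g = 12 := Nat.div_mul_cancel hd
  rw [he] at h1
  exact Nat.eq_of_mul_eq_mul_left hq (h1.trans h2.symm)

end Defect

/-! ### (G)-ordinarity is an isogeny invariant (every odd `p`) -/

section TypeGOrd

variable {W W' : WeierstrassCurve ℚ} [W.IsElliptic] [W.IsGloballyMinimal] [W'.IsElliptic]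
  [W'.IsGloballyMinimal] {p : ℕ} [hp : Fact p.Prime]

/-- **(G)-ordinarity is a `ℚ`-isogeny invariant on the additive locus, `p ≥ 5`** (globally minimal
models): `E` additive at `p`, `TypeGOrd W p`, `E ∼ E'` ⟹ `TypeGOrd W' p`.
* Defect `e ≠ 2`: `E'` is additive of type (G) with the same defect (`Addv.of_isIsogenous_of_typeG`,
  `TypeG.of_isIsogenous`, `semistabilityIndex_eq_of_isIsogenous_of_typeG`), hence (G)-ORDINARY by
  gen 5's `typeGOrd_of_typeG_of_semistabilityIndex_ne_two` (Deuring: `j̃ ∈ {0, 1728}` with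
  `3 ∣ p − 1` resp. `4 ∣ p − 1`).
* Defect `2` (Kodaira I₀*): gen 4's dictionary `typeGOrd_iff_goodOrd_twist_pStar` reads (G)-ordinarity
  as "a globally minimal model of the twist `E^{(p*)}` is good ORDINARY at `p`"; the twists
  `E^{(p*)} ∼ E'^{(p*)}` are isogenous (Cremona §3.9, `IsIsogenous.quadraticTwist`), both good at `p`
  (gen 3 `hasGoodReductionAtPrime_twist_pStar`), so they have the same `a_p`
  (`frobeniusTrace_eq_of_isIsogenous`, Faltings Kor. 2 (i) ⇒ (iv) / *AEC* Ex. 5.4): `p ∤ a_p`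
  transfers. -/
theorem TypeGOrd.of_isIsogenous_of_five_le (hp5 : 5 ≤ p) (hadd : Addv W p)
    (hG : TypeGOrd W p) (h : IsIsogenous W W') : TypeGOrd W' p := by
  have hp2 : p ≠ 2 := by omega
  have hGW : TypeG W p := hG.typeG
  have hG' : TypeG W' p := hGW.of_isIsogenous h
  have hadd' : Addv W' p := Addv.of_isIsogenous_of_typeG hadd hGW h
  have he : semistabilityIndex W' p = semistabilityIndex W p :=
    semistabilityIndex_eq_of_isIsogenous_of_typeG hp5 hGW h
  by_cases he2 : semistabilityIndex W p = 2
  · -- defect 2: through the good ordinary twists by `p*`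
    have he2' : semistabilityIndex W' p = 2 := he.trans he2
    obtain ⟨Wd, iWd, iWdm, C, hC, hord⟩ := exists_goodOrd_twist_pStar_of_typeGOrd W p hp5 hG he2
    set d : ℚ := (-1 : ℚ) ^ (p / 2) * p with hddef
    have hd0 : d ≠ 0 :=
      mul_ne_zero (pow_ne_zero _ (by norm_num)) (by exact_mod_cast hp.out.ne_zero)
    haveI : NeZero (2 : ℚ) := ⟨two_ne_zero⟩
    haveI : (W'.quadraticTwist d).IsElliptic := W'.isElliptic_quadraticTwist hd0
    haveI : (W.quadraticTwist d).IsElliptic := W.isElliptic_quadraticTwist hd0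
    obtain ⟨C', hC'⟩ := hasGlobalMinimalModel_rat_holds (W'.quadraticTwist d)
    haveI := hC'
    set Wd' : WeierstrassCurve ℚ := C' • W'.quadraticTwist d with hWd'
    have hgood' : Wd'.HasGoodReductionAtPrime p :=
      hasGoodReductionAtPrime_twist_pStar W' p hp5 (padicValRat_j_nonneg_of_typeG W' p hG')
        ((semistabilityIndex_eq_two_iff W' p).mp he2') Wd' C' rfl
    -- `Wd ∼ W^{(d)} ∼ W'^{(d)} ∼ Wd'`
    have hiso : IsIsogenous Wd Wd' :=
      IsIsogenous.trans' (IsIsogenous.trans' (isIsogenous_of_smul_eq' hC) (h.quadraticTwist hd0))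
        (isIsogenous_of_smul_eq (rfl : C' • W'.quadraticTwist d = Wd'))
    have hap : Wd.frobeniusTrace p = Wd'.frobeniusTrace p :=
      frobeniusTrace_eq_of_isIsogenous hiso p hord.1 hgood'
    have hord' : GoodOrd Wd' p := ⟨hgood', hap ▸ hord.2⟩
    exact typeGOrd_of_goodOrd_quadraticTwist W' p hp2 Wd' C' rfl hord'
  · -- defect 3, 4, 6: type (G) is already (G)-ordinary
    have hne2' : semistabilityIndex W' p ≠ 2 := fun h2 ↦ he2 (he ▸ h2)
    obtain ⟨L, iF, iN, iC, F, hF⟩ := hG'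
    exact typeGOrd_of_typeG_of_semistabilityIndex_ne_two W' p hp5 hadd'
      ⟨L, iF, iN, iC, F, hF⟩ hne2' F hF

/-- **(G)-ordinarity is a `ℚ`-isogeny invariant on the additive locus, `p = 3`** (globally minimal
models). At `3` the dictionary is gen 7's: for `E` additive at `3`, `TypeGOrd W 3 ↔` "a globally
minimal model of the twist `E^{(−3)}` is good ORDINARY at `3`" (`typeGOrd_three_iff_goodOrd_twist`,
Tate's algorithm at `3`), and type (G) at `3` makes every globally minimal model of the twist GOOD at
`3` (`hasGoodReductionAtPrime_twist_three_of_typeG_of_addv`). The twists `E^{(−3)} ∼ E'^{(−3)}` are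
isogenous (`IsIsogenous.quadraticTwist`) and both good at `3`, so `a_3` agrees
(`frobeniusTrace_eq_of_isIsogenous`). -/
theorem TypeGOrd.of_isIsogenous_three {W W' : WeierstrassCurve ℚ} [W.IsElliptic]
    [W.IsGloballyMinimal] [W'.IsElliptic] [W'.IsGloballyMinimal] (hadd : Addv W 3)
    (hG : TypeGOrd W 3) (h : IsIsogenous W W') : TypeGOrd W' 3 := by
  have hGW : TypeG W 3 := hG.typeG
  have hG' : TypeG W' 3 := hGW.of_isIsogenous h
  have hadd' : Addv W' 3 := Addv.of_isIsogenous_of_typeG hadd hGW h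
  set d : ℚ := (-1 : ℚ) ^ ((3 : ℕ) / 2) * (3 : ℕ) with hddef
  have hd0 : d ≠ 0 := mul_ne_zero (pow_ne_zero _ (by norm_num)) (by norm_num)
  haveI : NeZero (2 : ℚ) := ⟨two_ne_zero⟩
  haveI : (W.quadraticTwist d).IsElliptic := W.isElliptic_quadraticTwist hd0
  haveI : (W'.quadraticTwist d).IsElliptic := W'.isElliptic_quadraticTwist hd0
  obtain ⟨C, hC⟩ := hasGlobalMinimalModel_rat_holds (W.quadraticTwist d)
  obtain ⟨C', hC'⟩ := hasGlobalMinimalModel_rat_holds (W'.quadraticTwist d)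
  haveI := hC
  haveI := hC'
  have hord : GoodOrd (C • W.quadraticTwist d) 3 :=
    goodOrd_twist_three_of_typeGOrd W hG hadd (C • W.quadraticTwist d) ⟨C, rfl⟩
  have hgood' : (C' • W'.quadraticTwist d).HasGoodReductionAtPrime 3 :=
    hasGoodReductionAtPrime_twist_three_of_typeG_of_addv W' hG' hadd' (C' • W'.quadraticTwist d)
      ⟨C', rfl⟩
  -- `C • W^{(d)} ∼ W^{(d)} ∼ W'^{(d)} ∼ C' • W'^{(d)}`
  have hiso : IsIsogenous (C • W.quadraticTwist d) (C' • W'.quadraticTwist d) :=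
    IsIsogenous.trans' (IsIsogenous.trans' (isIsogenous_of_smul _ C) (h.quadraticTwist hd0))
      (isIsogenous_smul _ C')
  have hap : (C • W.quadraticTwist d).frobeniusTrace 3 = (C' • W'.quadraticTwist d).frobeniusTrace 3 :=
    frobeniusTrace_eq_of_isIsogenous hiso 3 hord.1 hgood'
  have hord' : GoodOrd (C' • W'.quadraticTwist d) 3 := ⟨hgood', hap ▸ hord.2⟩
  exact (typeGOrd_three_iff_goodOrd_twist W' hadd' (C' • W'.quadraticTwist d) C' rfl).mpr hord'

/-- **(G)-ORDINARITY is a `ℚ`-isogeny invariant on the additive locus at EVERY odd prime** (globally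
minimal models): `E` additive at `p`, `TypeGOrd W p`, `E ∼ E'` ⟹ `TypeGOrd W' p`
(`…_of_five_le` at `p ≥ 5`, `…_three` at `p = 3`). -/
theorem TypeGOrd.of_isIsogenous (hp2 : p ≠ 2) (hadd : Addv W p) (hG : TypeGOrd W p)
    (h : IsIsogenous W W') : TypeGOrd W' p := by
  rcases eq_three_or_five_le_of_prime_ne_two p hp.out hp2 with rfl | hp5
  · exact hG.of_isIsogenous_three hadd h
  · exact hG.of_isIsogenous_of_five_le hp5 hadd h

/-- **(G)-ordinarity is constant on `ℚ`-isogeny classes** (odd `p`, `E` additive at `p`, globally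
minimal models): `TypeGOrd W p ↔ TypeGOrd W' p`. -/
theorem typeGOrd_iff_of_isIsogenous (hp2 : p ≠ 2) (hadd : Addv W p) (h : IsIsogenous W W') :
    TypeGOrd W p ↔ TypeGOrd W' p := by
  refine ⟨fun hG ↦ hG.of_isIsogenous hp2 hadd h, fun hG' ↦ ?_⟩
  have hadd' : Addv W' p := Addv.of_isIsogenous_of_typeG hadd
    (hG'.typeG.of_isIsogenous h.symm_of_charZero) h
  exact hG'.of_isIsogenous hp2 hadd' h.symm_of_charZero

end TypeGOrd

end Summit.BirchSwinnertonDyer.Rank1Residual.Additive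

end
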